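import Summits.SmoothPoincare4.SmoothPoincare4.Theses.SymplecticOrigami
import Summits.SmoothPoincare4.SmoothPoincare4.Theorems.SymplecticOrigamiOrigamiRungPinchBookkeeping
import Summits.SmoothPoincare4.SmoothPoincare4.Theorems.SymplecticOrigamiOrigamiRungStubPinchSepFun
import Summits.SmoothPoincare4.SmoothPoincare4.Theorems.SymplecticOrigamiOrigamiRungStubPinchAlexander
import Summits.SmoothPoincare4.SmoothPoincare4.Theorems.SymplecticOrigamiOrigamiRungStubPinchPieceLES
import Summits.SmoothPoincare4.SmoothPoincare4.Theorems.SymplecticOrigamiOrigamiRungStubPinchSurfaceNbhdPair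
import Summits.SmoothPoincare4.SmoothPoincare4.Theorems.SymplecticOrigamiOrigamiRungStubPinchExceptionalNbhdIso
import Summits.SmoothPoincare4.SmoothPoincare4.Theorems.SymplecticOrigamiOrigamiRungStubPinchPieceHomeomorph
import Literature.Topology.FourManifolds.HomotopyS4CompactProofs
import Literature.Topology.FourManifolds.SurfaceFirstBettiEven
import Literature.AlgebraicTopology.SingularHomology.RationalEulerCharacteristic
import Literature.Geometry.Symplectic.CodimTwoComplementConnected
import Literature.Geometry.Symplectic.EulerCharacteristicAddSignatureOfSymplecticFour

/-!
# The pinch of line `pair-rigidity-endgame` from its reshape-r3 stubs and the parity fact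
# (crux `SymplecticOrigami.OrigamiRung`, item stmt-SmoothPoincare4-7843)

`stub_pinch_of_parity` (registered stub of the line): for fold data on a homotopy `4`-sphere
there are `g` and `k 0 + k 1 = 2g` with `b₁(S i) = 2g`, `b₂(N i) = 1` and
`H₁(N i ∖ B i; ℤ) ≃+ ℤ^{k i}` for both pieces — GRANTED the Literature fact
`Literature.Geometry.Symplectic.even_one_add_bOne_add_bPlus_of_symplectic_four` (`χ + σ ≡ 0 (4)`
for closed symplectic `4`-manifolds; McDuff–Salamon 2017 §13.3 p. 527), and otherwise from
theorems of the tree: the five landed stubs of the line (`stub_pinch_sepFun`,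
`stub_pinch_alexander`, `stub_pinch_pieceLES`, `stub_pinch_exceptionalNbhdIso`,
`stub_pinch_surfaceNbhdPair`), the bookkeeping lemmas of `…PinchBookkeeping.lean`, the symplectic
orientation with `b⁺ ≥ 1` (`exists_isSymplecticOrientationOf_one_le_sigPos`), non-torsion of
symplectic surfaces, mod-`p` Betti numbers and Poincaré duality over fields.

Bookkeeping (all ranks over a field `F`; `aᵢ, cᵢ, tᵢ = b₁, b₂, b₃(N i ∖ B i)`, `nᵢ, mᵢ = b₁,
b₂(N i)`, `sᵢ = b₁(S i)`, `r = b₁(Z)`): Alexander duality `r = a₀ + a₁`, `a₀ = c₁`, `a₁ = c₀`,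
`tᵢ = 0`; piece `nᵢ ≤ aᵢ ≤ nᵢ + 1`, `cᵢ + 2nᵢ + 1 = sᵢ + mᵢ + aᵢ + tᵢ`; neighbourhood pair
`sᵢ ≤ r ≤ sᵢ + 1`; with `mᵢ ≥ 1`: `aᵢ = nᵢ`, `mᵢ + sᵢ = r + 1` (`pinch_arith`).  Over `ℚ`: `sᵢ`
even, `mᵢ ∈ {1, 2}` equal, genera equal; `mᵢ = 2` ⇒ rational kernel `≠ 0` ⇒ `[B i]` carried by
the complement ⇒ `b₁(N i)` even for both `i` (`even_bettiNumber_one_of_carried`, the parity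
fact) ⇒ `r = n₀ + n₁` even, contradicting `r = 2g + 1`; so `b₂(N i) = 1`, `r = 2g`.  Over `𝔽ₚ`:
`b₂(N i; 𝔽ₚ) = 1 + 2 t_p(H₁ N i) ∈ {1, 2}` ⇒ `t_p(H₁ N i) = 0` ⇒ `t_p(H₁(N i ∖ B i)) = 0`, so
`H₁(N i ∖ B i; ℤ)` is free of rank `aᵢ` (`nonempty_addEquiv_pi_of_card_ker`).
-/

noncomputable section

-- the prescribed namespace `Summit.<P>.<Sub>.…` duplicates `SmoothPoincare4` (P = Sub)
set_option linter.dupNamespace false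

open scoped Manifold ContDiff Topology ContinuousMap
open Set TopologicalSpace
open Literature.Topology.FourManifolds (singularHomologyZ)
open Literature.Geometry.Kaehler (MForm IsSmoothForm IsClosedForm)
open Literature.AlgebraicTopology.SingularHomology (singularHomology HomologicalOrientation
  singularCohomology poincareDualityMap cupPairing intersectionForm bettiNumber freeCohomology)

namespace Summit.SmoothPoincare4.SmoothPoincare4.Theorems.OrigamiRung.PairRigidityEndgame

section Pinch

open Literature.AlgebraicTopology.SingularHomology Literature.Geometry.Symplectic Module
  CategoryTheory

/-- **The SW-free integral pinch, from the reshape-r3 stubs and the parity fact.**  For fold data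
on a homotopy `4`-sphere there are `g` and `k 0 + k 1 = 2g` with `b₁(S i) = 2g`, `b₂(N i) = 1`
and `H₁(N i ∖ B i; ℤ) ≅ ℤ^{k i}` free, for both pieces.  Proof: the separating function `τ`
(`stub_pinch_sepFun`); Alexander duality in `M` (`stub_pinch_alexander`), the exact sequence of
each piece (`stub_pinch_pieceLES`), the exceptional neighbourhoods (`stub_pinch_exceptionalNbhdIso`)
and their pairs (`stub_pinch_surfaceNbhdPair`) give, over every field, `aᵢ = nᵢ`,
`mᵢ + sᵢ = r + 1`, `sᵢ ≤ r ≤ sᵢ + 1` (`pinch_arith`); over `ℚ`, `mᵢ = 2` is the isotropic case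
excluded by `even_bettiNumber_one_of_carried` (parity), so `b₂(N i) = 1`, `r = 2g`; over `𝔽ₚ`,
`b₂(N i; 𝔽ₚ) = 1 + 2t_p(H₁ N i) ∈ {1, 2}` forces `t_p = 0` and then `t_p(H₁(N i ∖ B i)) = 0`,
so the `H₁` of the complements are free (`nonempty_addEquiv_pi_of_card_ker`). [folklore] -/
theorem stub_pinch_of_parity :
      Literature.Geometry.Symplectic.even_one_add_bOne_add_bPlus_of_symplectic_four → ∀ (M : Type)
      [TopologicalSpace M] [T2Space M] [SecondCountableTopology M] [ChartedSpace (EuclideanSpace ℝ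
      (Fin 4)) M] [IsManifold (𝓡 4) ∞ M], M ≃ₕ (Metric.sphere (0 : EuclideanSpace ℝ (Fin 5)) 1) →
      ∀ (V : Fin 2 → TopologicalSpace.Opens M) (N : Fin 2 → Type) [∀ i, TopologicalSpace (N i)] [∀
      i, T2Space (N i)] [∀ i, SecondCountableTopology (N i)] [∀ i, CompactSpace (N i)] [∀ i,
      ConnectedSpace (N i)] [∀ i, ChartedSpace (EuclideanSpace ℝ (Fin 4)) (N i)] [∀ i, IsManifold
      (𝓡 4) ∞ (N i)] (s : ∀ i, Literature.Geometry.Kaehler.MForm (𝓡 4) (N i) ℝ 2) (S : Fin 2 →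
      Type) [∀ i, TopologicalSpace (S i)] [∀ i, CompactSpace (S i)] [∀ i, ConnectedSpace (S i)] [∀
      i, ChartedSpace (EuclideanSpace ℝ (Fin 2)) (S i)] [∀ i, IsManifold (𝓡 2) ∞ (S i)] (b : ∀ i,
      S i → N i) (β : ∀ i, M → N i), Disjoint (V 0) (V 1) ∧ (∀ i, (V i : Set M).Nonempty) ∧
      IsConnected ((V 0 : Set M) ∪ (V 1 : Set M))ᶜ ∧ (∃ (Z : Type) (_ : TopologicalSpace Z) (_ :
      ChartedSpace (EuclideanSpace ℝ (Fin 3)) Z) (_ : IsManifold (𝓡 3) ∞ Z) (z : Z → M),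
      Manifold.IsSmoothEmbedding (𝓡 3) (𝓡 4) ∞ z ∧ Set.range z = ((V 0 : Set M) ∪ (V 1 : Set M))ᶜ)
      → (∀ i, Literature.Geometry.Kaehler.IsSmoothForm (s i) ∧
      Literature.Geometry.Kaehler.IsClosedForm (s i) ∧ (∀ x (v : TangentSpace (𝓡 4) x), v ≠ 0 → ∃
      w, s i x ![v, w] ≠ 0) ∧ Manifold.IsSmoothEmbedding (𝓡 2) (𝓡 4) ∞ (b i) ∧ (∀ y (v :
      TangentSpace (𝓡 2) y), v ≠ 0 → ∃ w : TangentSpace (𝓡 2) y, s i (b i y) ![mfderiv (𝓡 2) (𝓡 4)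
      (b i) y v, mfderiv (𝓡 2) (𝓡 4) (b i) y w] ≠ 0) ∧ (∃ U : Set M, IsOpen U ∧ closure (V i : Set
      M) ⊆ U ∧ ContMDiffOn (𝓡 4) (𝓡 4) ∞ (β i) U) ∧ Set.InjOn (β i) (V i : Set M) ∧ β i '' (V i :
      Set M) = (Set.range (b i))ᶜ ∧ (∀ x ∈ (V i : Set M), Function.Bijective (mfderiv (𝓡 4) (𝓡 4)
      (β i) x)) ∧ β i '' frontier (V i : Set M) ⊆ Set.range (b i) ∧ (∀ x ∈ frontier (V i : Set M),
      Module.finrank ℝ (LinearMap.ker (mfderiv (𝓡 4) (𝓡 4) (β i) x).toLinearMap) = 1)) → (∀ i,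
      frontier (V i : Set M) = ((V 0 : Set M) ∪ (V 1 : Set M))ᶜ ∧ interior (closure (V i : Set M))
      = (V i : Set M)) → ∃ (g : ℕ) (k : Fin 2 → ℕ), k 0 + k 1 = 2 * g ∧ ∀ i, Module.finrank ℤ
      (Literature.Topology.FourManifolds.singularHomologyZ (S i) 1) = 2 * g ∧ Module.finrank ℤ
      (Literature.Topology.FourManifolds.singularHomologyZ (N i) 2) = 1 ∧ Nonempty
      (Literature.Topology.FourManifolds.singularHomologyZ (↥((Set.range (b i))ᶜ)) 1 ≃+ (Fin (k i)
      → ℤ)) := by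
  intro hP M _ _ _ _ _ e V N _ _ _ _ _ _ _ s S _ _ _ _ _ b β hdata hprops hsides
  classical
  /- §0 the ambient homotopy sphere -/
  haveI : CompactSpace M :=
    Literature.Topology.FourManifolds.compactSpace_of_homotopyEquiv_sphere_four_holds M e
  haveI : PathConnectedSpace M := by
    haveI := Literature.Topology.FourManifolds.pathConnectedSpace_sphere_four
    exact Literature.Topology.FourManifolds.pathConnectedSpace_of_homotopyEquiv e
  obtain ⟨hdisj, -, -, Z, _, _, _, z, hz, hrange⟩ := hdata
  /- §1 the separating function and the fold as its regular zero set -/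
  have hfr : ∀ i, frontier (V i : Set M) = Set.range z := fun i => (hsides i).1.trans hrange.symm
  obtain ⟨τ, hτ, hreg, hV0, hV1⟩ := stub_pinch_sepFun M V Z z hdisj hz hrange hfr
  have hZ0 : {x : M | τ x = 0} = Set.range z := by
    rw [hrange, ← hV0, ← hV1]
    ext x
    simp only [mem_setOf_eq, mem_compl_iff, mem_union, not_or, not_lt]
    constructor
    · intro h; exact ⟨h.ge, h.le⟩
    · intro h; exact le_antisymm h.2 h.1
  haveI : T2Space Z := hz.isEmbedding.t2Space
  haveI : CompactSpace Z := by
    have hc : IsCompact (Set.range z) := by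
      rw [hrange]
      exact ((V 0).isOpen.union (V 1).isOpen).isClosed_compl.isCompact
    exact isCompact_univ_iff.1 (hz.isEmbedding.isInducing.isCompact_iff.2 (by rwa [image_univ]))
  -- `Z ≃ₜ {τ = 0}`
  have eZ : Z ≃ₜ ↥{x : M | τ x = 0} :=
    hz.isEmbedding.toHomeomorph.trans (Homeomorph.setCongr hZ0.symm)
  have hVor : ∀ i : Fin 2, (V i : Set M) = {x : M | τ x < 0} ∨ (V i : Set M) = {x : M | 0 < τ x} := by
    intro i; fin_cases i
    exacts [Or.inl hV0.symm, Or.inr hV1.symm]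
  /- §2 the pieces: blow-down homeomorphisms, connectedness, orientations, the four N-side stubs -/
  have hsm : ∀ i, ContMDiffOn (𝓡 4) (𝓡 4) ∞ (β i) (V i : Set M) := fun i => by
    obtain ⟨U, -, hclU, hU⟩ := (hprops i).2.2.2.2.2.1
    exact hU.mono (subset_closure.trans hclU)
  have heV : ∀ i, Nonempty (↥(V i : Set M) ≃ₜ ↥(Set.range (b i))ᶜ) := fun i => by
    obtain ⟨eV, -⟩ := stub_pinch_pieceHomeomorph M (N i) (V i) (Set.range (b i)) (β i) (hsm i)
      (hprops i).2.2.2.2.2.2.1 (hprops i).2.2.2.2.2.2.2.1 (hprops i).2.2.2.2.2.2.2.2.1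
    exact ⟨eV⟩
  have eV : ∀ i, ↥(V i : Set M) ≃ₜ ↥(Set.range (b i))ᶜ := fun i => Classical.choice (heV i)
  have hconnX : ∀ i, IsConnected (Set.range (b i))ᶜ := fun i =>
    isConnected_compl_range_of_isSmoothEmbedding_holds 2 4 (N i) (S i) (b i) le_rfl
      (hprops i).2.2.2.1
  haveI hcX : ∀ i, ConnectedSpace ↥(Set.range (b i))ᶜ := fun i =>
    isConnected_iff_connectedSpace.1 (hconnX i)
  haveI : ∀ i, LocallyPathConnectedSpace ↥(Set.range (b i))ᶜ := fun i => by
    haveI : LocallyPathConnectedSpace (N i) := ChartedSpace.locallyPathConnectedSpace (EuclideanSpace ℝ (Fin 4)) (N i)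
    exact (isCompact_range (hprops i).2.2.2.1.isEmbedding.continuous).isClosed.isOpen_compl
      |>.locallyPathConnectedSpace
  haveI hpX : ∀ i, PathConnectedSpace ↥(Set.range (b i))ᶜ := fun i =>
    pathConnectedSpace_iff_connectedSpace.2 (hcX i)
  have hcV : ∀ i, IsConnected (V i : Set M) := fun i => by
    haveI : ConnectedSpace ↥(V i : Set M) :=
      (eV i).symm.surjective.connectedSpace (eV i).symm.continuous
    exact isConnected_iff_connectedSpace.2 inferInstance
  have hc0 : IsConnected {x : M | τ x < 0} := by rw [hV0]; exact hcV 0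
  have hc1 : IsConnected {x : M | 0 < τ x} := by rw [hV1]; exact hcV 1
  -- orientations
  haveI hT2S : ∀ i, T2Space (S i) := fun i => (hprops i).2.2.2.1.isEmbedding.t2Space
  have hμN : ∀ i, ∃ μ : HomologicalOrientation ℤ (N i) 4,
      μ.IsSymplecticOrientationOf (s i) (hprops i).1 (hprops i).2.1 ∧
      1 ≤ sigPos (intersectionForm two_add_two_eq_four μ).toQuadraticMap := fun i =>
    exists_isSymplecticOrientationOf_one_le_sigPos (s i) (hprops i).1 (hprops i).2.1
      (hprops i).2.2.1
  choose μN hμN hposN using hμN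
  have hμS : ∀ i, Nonempty (HomologicalOrientation ℤ (S i) 2) := fun i =>
    nonempty_orientation_surface (s i) (hprops i).1 (hprops i).2.2.2.1 (hprops i).2.2.2.2.1
  have μS : ∀ i, HomologicalOrientation ℤ (S i) 2 := fun i => Classical.choice (hμS i)
  -- the four N-side stubs
  have PL := fun i => stub_pinch_pieceLES (N i) (S i) (b i) ⟨μN i⟩ ⟨μS i⟩ (hprops i).2.2.2.1
  have EX : ∀ i, ∃ D : Set (N i), IsOpen D ∧ Set.range (b i) ⊆ D ∧
      ∀ (F : Type) [Field F] (k : ℕ),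
        Nonempty (singularHomology F F ↥D k ≃ₗ[F] singularHomology F F (S i) k) ∧
          Nonempty (singularHomology F F ↥(D \ Set.range (b i)) k ≃ₗ[F]
            singularHomology F F ↥{x : M | τ x = 0} k) := fun i =>
    stub_pinch_exceptionalNbhdIso M (N i) (S i) τ (V i : Set M) (b i) (β i) hτ hreg (hVor i)
      (hprops i).2.2.2.1 (hprops i).2.2.2.2.2.1 (hprops i).2.2.2.2.2.2.1
      (hprops i).2.2.2.2.2.2.2.1 (hprops i).2.2.2.2.2.2.2.2.1 (hprops i).2.2.2.2.2.2.2.2.2.1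
  choose D hDo hBD hDiso using EX
  have NP := fun i => stub_pinch_surfaceNbhdPair (N i) (S i) (b i) (hprops i).2.2.2.1 (D i)
    (hDo i) (hBD i) ⟨μN i⟩ ⟨μS i⟩
  /- §3 the rank bookkeeping over an arbitrary field -/
  have key : ∀ (F : Type) [Field F], (∀ i, 1 ≤ bettiNumber F (N i) 2) →
      bettiNumber F ↥{x : M | τ x = 0} 1 =
          bettiNumber F ↥(Set.range (b 0))ᶜ 1 + bettiNumber F ↥(Set.range (b 1))ᶜ 1 ∧
        ∀ i, bettiNumber F ↥(Set.range (b i))ᶜ 1 = bettiNumber F (N i) 1 ∧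
          bettiNumber F (N i) 2 + bettiNumber F (S i) 1 = bettiNumber F ↥{x : M | τ x = 0} 1 + 1 ∧
          bettiNumber F (S i) 1 ≤ bettiNumber F ↥{x : M | τ x = 0} 1 ∧
          bettiNumber F ↥{x : M | τ x = 0} 1 ≤ bettiNumber F (S i) 1 + 1 ∧
          (bettiNumber F ↥{x : M | τ x = 0} 1 = bettiNumber F (S i) 1 + 1 →
            LinearMap.ker (singularHomology.map F F
              (⟨Set.inclusion Set.sdiff_subset, continuous_inclusion Set.sdiff_subset⟩ :
                C(↥(D i \ Set.range (b i)), ↥(D i))) 1).hom ≠ ⊥) := by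
    intro F _ hm1
    -- finiteness on the pieces, transported to the sides of `τ`
    have hfinX : ∀ i k, Module.Finite F (singularHomology F F ↥(Set.range (b i))ᶜ k) :=
      fun i k => ((PL i).2 F).1 k
    have e0 : ↥{x : M | τ x < 0} ≃ₜ ↥(Set.range (b 0))ᶜ := (Homeomorph.setCongr hV0).trans (eV 0)
    have e1 : ↥{x : M | 0 < τ x} ≃ₜ ↥(Set.range (b 1))ᶜ := (Homeomorph.setCongr hV1).trans (eV 1)
    have l0 : ∀ k, ↥(singularHomology F F ↥{x : M | τ x < 0} k) ≃ₗ[F]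
        ↥(singularHomology F F ↥(Set.range (b 0))ᶜ k) := fun k =>
      (singularHomology.mapIso F F e0 k).toLinearEquiv
    have l1 : ∀ k, ↥(singularHomology F F ↥{x : M | 0 < τ x} k) ≃ₗ[F]
        ↥(singularHomology F F ↥(Set.range (b 1))ᶜ k) := fun k =>
      (singularHomology.mapIso F F e1 k).toLinearEquiv
    have hf0 : ∀ k, Module.Finite F (singularHomology F F ↥{x : M | τ x < 0} k) := fun k =>
      haveI := hfinX 0 k; Module.Finite.equiv (l0 k).symm
    have hf1 : ∀ k, Module.Finite F (singularHomology F F ↥{x : M | 0 < τ x} k) := fun k =>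
      haveI := hfinX 1 k; Module.Finite.equiv (l1 k).symm
    -- Alexander duality across the fold
    obtain ⟨hr, h01, h10, ht0, ht1⟩ := stub_pinch_alexander M e τ hτ hreg hc0 hc1 F hf0 hf1
    rw [(l0 1).finrank_eq, (l1 1).finrank_eq] at hr
    rw [(l0 1).finrank_eq, (l1 2).finrank_eq] at h01
    rw [(l1 1).finrank_eq, (l0 2).finrank_eq] at h10
    rw [(l0 3).finrank_eq] at ht0
    rw [(l1 3).finrank_eq] at ht1
    -- finiteness of `H₁({τ = 0}; F)` (a compact `3`-manifold)
    haveI hfZ : Module.Finite F (singularHomology F F ↥{x : M | τ x = 0} 1) := by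
      haveI : Module.Finite F (singularHomology F F Z 1) :=
        finite_singularHomology_of_compactSpace_holds (R := F) Z 3 1
      exact Module.Finite.equiv (singularHomology.mapIso F F eZ 1).toLinearEquiv
    -- the neighbourhood pair of each piece: `sᵢ ≤ r ≤ sᵢ + 1`
    have hnb : ∀ i, bettiNumber F (S i) 1 ≤ bettiNumber F ↥{x : M | τ x = 0} 1 ∧
        bettiNumber F ↥{x : M | τ x = 0} 1 ≤ bettiNumber F (S i) 1 + 1 ∧
        (bettiNumber F ↥{x : M | τ x = 0} 1 = bettiNumber F (S i) 1 + 1 →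
          LinearMap.ker (singularHomology.map F F
            (⟨Set.inclusion Set.sdiff_subset, continuous_inclusion Set.sdiff_subset⟩ :
              C(↥(D i \ Set.range (b i)), ↥(D i))) 1).hom ≠ ⊥) := by
      intro i
      obtain ⟨⟨eD⟩, ⟨eDB⟩⟩ := hDiso i F 1
      obtain ⟨hsurj, hker⟩ := (NP i).1 F
      set π := (singularHomology.map F F
        (⟨Set.inclusion Set.sdiff_subset, continuous_inclusion Set.sdiff_subset⟩ :
          C(↥(D i \ Set.range (b i)), ↥(D i))) 1).hom with hπ
      haveI : Module.Finite F (singularHomology F F ↥(D i \ Set.range (b i)) 1) :=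
        Module.Finite.equiv eDB.symm
      have hrn := LinearMap.finrank_range_add_finrank_ker π
      have htop : LinearMap.range π = ⊤ := LinearMap.range_eq_top.2 hsurj
      rw [htop, finrank_top, eD.finrank_eq, eDB.finrank_eq] at hrn
      unfold bettiNumber
      refine ⟨by omega, by omega, fun h hbot => ?_⟩
      rw [hbot, finrank_bot] at hrn
      omega
    -- the piece relations and the arithmetic
    refine ⟨hr, fun i => ?_⟩
    obtain ⟨-, hn, hn', hrel⟩ := (PL i).2 F
    obtain ⟨hs1, hs2, hkr⟩ := hnb i
    unfold bettiNumber at hm1 hs1 hs2 hkr ⊢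
    have hm1i := hm1 i
    fin_cases i
    · obtain ⟨ha, hms⟩ := pinch_arith hr h01 h10 ht0 hn hn' hrel hs1 hs2 hm1i
      exact ⟨ha, hms, hs1, hs2, hkr⟩
    · rw [add_comm] at hr
      obtain ⟨ha, hms⟩ := pinch_arith hr h10 h01 ht1 hn hn' hrel hs1 hs2 hm1i
      exact ⟨ha, hms, hs1, hs2, hkr⟩
  /- §4 over `ℚ`: `b₂(N i) = 1`, equal genera, `a₀ + a₁ = 2g` -/
  have hLrank : ∀ i, Module.finrank ℤ ↥(freeCohomology ℤ (N i) 2) = bettiNumber ℚ (N i) 2 := fun i =>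
    Literature.Topology.FourManifolds.finrank_freeCohomology_two_eq_bettiNumber_of_compactSpace
  have hmQ : ∀ i, 1 ≤ bettiNumber ℚ (N i) 2 := fun i => by
    rw [← hLrank i]
    exact (hposN i).trans (sigPos_le_finrank _)
  obtain ⟨hrQ, hkQ⟩ := key ℚ hmQ
  -- integral Betti numbers are the rational ones
  have hZQ : ∀ (Y : Type) [TopologicalSpace Y] (k : ℕ), bettiNumber ℤ Y k = bettiNumber ℚ Y k :=
    fun Y _ k => bettiNumber_int_eq_rat Y k
  -- `b₁(S i)` is even
  have hev : ∀ i, ∃ γ : ℕ, bettiNumber ℚ (S i) 1 = 2 * γ := fun i => by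
    obtain ⟨γ, hγ⟩ := Literature.Topology.FourManifolds.even_finrank_singularHomology_one_of_orientation
      (μS i)
    refine ⟨γ, ?_⟩
    rw [← hZQ]
    unfold bettiNumber
    omega
  choose γ hγ using hev
  obtain ⟨ha0, hms0, hs01, hs02, hkr0⟩ := hkQ 0
  obtain ⟨ha1, hms1, hs11, hs12, hkr1⟩ := hkQ 1
  have hγ0 := hγ 0
  have hγ1 := hγ 1
  -- `m₀ = m₁ ∈ {1, 2}` and `γ₀ = γ₁`
  have hm12 : (bettiNumber ℚ (N 0) 2 = 1 ∧ bettiNumber ℚ (N 1) 2 = 1 ∧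
      bettiNumber ℚ ↥{x : M | τ x = 0} 1 = 2 * γ 0 ∧ γ 1 = γ 0) ∨
      (bettiNumber ℚ (N 0) 2 = 2 ∧ bettiNumber ℚ (N 1) 2 = 2 ∧
        bettiNumber ℚ ↥{x : M | τ x = 0} 1 = 2 * γ 0 + 1 ∧ γ 1 = γ 0) := by
    have := hmQ 0
    have := hmQ 1
    omega
  -- the isotropic case is excluded by parity
  have hgood : bettiNumber ℚ (N 0) 2 = 1 ∧ bettiNumber ℚ (N 1) 2 = 1 ∧
      bettiNumber ℚ ↥{x : M | τ x = 0} 1 = 2 * γ 0 ∧ γ 1 = γ 0 := by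
    rcases hm12 with h | ⟨hm0, hm1, hr1, hγ10⟩
    · exact h
    · exfalso
      have heven : ∀ i, bettiNumber ℚ (N i) 2 = 2 →
          bettiNumber ℚ ↥{x : M | τ x = 0} 1 = bettiNumber ℚ (S i) 1 + 1 →
          Even (bettiNumber ℤ (N i) 1) := by
        intro i hm2 hr2
        have hker := (hkQ i).2.2.2.2 hr2
        exact even_bettiNumber_one_of_carried (N i) (s i) (hprops i).1 (hprops i).2.1
          (hprops i).2.2.1 (hP (N i) (s i) (hprops i).1 (hprops i).2.1 (hprops i).2.2.1)
          (S i) (b i) (hprops i).2.2.2.1 (hprops i).2.2.2.2.1 hm2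
          (⟨Subtype.val, continuous_subtype_val⟩ : C(↥(D i \ Set.range (b i)), N i))
          (by
            rw [Set.disjoint_iff]
            rintro y ⟨hyB, ⟨w, rfl⟩⟩
            exact w.2.2 hyB)
          ((NP i).2 hker)
      have he0 : Even (bettiNumber ℤ (N 0) 1) := heven 0 hm0 (by omega)
      have he1 : Even (bettiNumber ℤ (N 1) 1) := heven 1 hm1 (by omega)
      rw [hZQ] at he0 he1
      obtain ⟨w0, hw0⟩ := he0
      obtain ⟨w1, hw1⟩ := he1
      omega
  obtain ⟨hm0, hm1, hr0, hγ10⟩ := hgood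
  /- §5 over `𝔽ₚ`: no `p`-torsion in `H₁(N i ∖ B i; ℤ)` -/
  have hfinA : ∀ i, Module.Finite ℤ (singularHomology ℤ ℤ ↥(Set.range (b i))ᶜ 1) := fun i => (PL i).1
  have htf : ∀ i (p : ℕ), p.Prime →
      Nat.log p (Nat.card (zsmulAddGroupHom
        (α := singularHomology ℤ ℤ ↥(Set.range (b i))ᶜ 1) (p : ℤ)).ker) = 0 := by
    intro i p hp
    haveI : Fact p.Prime := ⟨hp⟩
    -- mod-`p` Betti numbers of the closed pieces and of the surfaces
    have hNp := fun j => bettiNumber_zmod_closed_four (N j) (μN j) p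
    have hmP : ∀ j, 1 ≤ bettiNumber (ZMod p) (N j) 2 := fun j => by
      rw [(hNp j).2, hZQ]
      have := hmQ j
      omega
    obtain ⟨-, hkP⟩ := key (ZMod p) hmP
    obtain ⟨haP, hmsP, hsP1, hsP2, -⟩ := hkP i
    -- the surface: `b₁(S i; 𝔽ₚ) = b₁(S i)`
    haveI : LocallyPathConnectedSpace (S i) := ChartedSpace.locallyPathConnectedSpace (EuclideanSpace ℝ (Fin 2)) (S i)
    haveI : PathConnectedSpace (S i) := pathConnectedSpace_iff_connectedSpace.2 inferInstance
    haveI : Module.Finite ℤ (singularHomology ℤ ℤ (S i) 1) :=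
      finite_singularHomology_of_compactSpace_holds (R := ℤ) (S i) 2 1
    have hSp := bettiNumber_zmod_one_eq (S i) p
    rw [log_card_ker_zsmul_eq_zero_of_torsion_eq_bot
      (torsion_singularHomology_eq_bot_of_isOrientableOver_holds (S i) 1 ⟨μS i⟩) p hp,
      add_zero, hZQ] at hSp
    -- the complement: `b₁(X i; 𝔽ₚ) = b₁(X i) + t_p`
    have hXp := bettiNumber_zmod_one_eq ↥(Set.range (b i))ᶜ p
    rw [hZQ] at hXp
    -- the closed piece
    obtain ⟨hN1, hN2⟩ := hNp i
    rw [hZQ] at hN1 hN2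
    -- rational values
    obtain ⟨haQ, hmsQ, -, -, -⟩ := hkQ i
    have hmi : bettiNumber ℚ (N i) 2 = 1 := by fin_cases i <;> assumption
    omega
  /- §6 conclusion -/
  refine ⟨γ 0, fun i => bettiNumber ℤ ↥(Set.range (b i))ᶜ 1, ?_, fun i => ⟨?_, ?_, ?_⟩⟩
  · show bettiNumber ℤ ↥(Set.range (b 0))ᶜ 1 + bettiNumber ℤ ↥(Set.range (b 1))ᶜ 1 = 2 * γ 0
    rw [hZQ, hZQ, ← hrQ, hr0]
  · show bettiNumber ℤ (S i) 1 = 2 * γ 0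
    rw [hZQ, hγ i]
    fin_cases i
    · rfl
    · show 2 * γ 1 = 2 * γ 0
      rw [hγ10]
  · show bettiNumber ℤ (N i) 2 = 1
    rw [hZQ]
    fin_cases i <;> assumption
  · exact nonempty_addEquiv_pi_of_card_ker (htf i) rfl

end Pinch

end Summit.SmoothPoincare4.SmoothPoincare4.Theorems.OrigamiRung.PairRigidityEndgame

end
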